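/-
Copyright (c) 2026 the pub-hodgecm-mathlib formalisation cell (harness21).  Prover seat hodgecm-mathlib-A-p12 (g25): road «S3-ram» (LEAD F0P3a-plan (g13); (Cnt2′) chair
F0P3a-p07 (g15) RULING (13) organ (4b), RULING (21) (g1); (α) keeper F0P3a-p06 (g16)); organ (K4b) frame, ED. 2 (literal-agnostic + A-even top); 2026-09-02.
-/
import Literature.NumberTheory.Rogawski1990.DepthZeroKappaTransferTypeTwoRamifiedHyperbolicVertexFrame   -- ★ p849477 (this seat): regime-B frame + helpers
import Literature.NumberTheory.Automorphic.UnitaryLatticeTreeBlockRootRegionAxisTop                  -- ★ p849253 (F0P3a-p01 (g18)): `single_one_one_mem_of_mem_rootRegion_of_top`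
import HarnessLib

/-!
# The ramified `κ`-orbital integral, TYPE (2): THE ADAPTED AXIS FRAME OF AN AXIS REGION VERTEX — literal-agnostic form and the A-EVEN TOP
# (organ (4b) frame, ED. 2; Kottwitz 1986 §3; Rogawski 1990 §4.9; Bruhat–Tits 1972 §10)

Topic `NumberTheory/Rogawski1990`; namespace `Literature.NumberTheory.Rogawski1990.TypeOneRamifiedJunction`.  THEOREMS ONLY (no definition, no instance, no notation, no
named fact, no `sorry`); kernel lane `--supports stmt-HodgeConjecture-24833`; datum-free; count-neutral.  Cell `pub/hodgecm-mathlib` (D-0151), crux H413; (Cnt2′) ROUTE B,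
chair RULING (13) organ (4b) (A-p12 (g25)) and RULING (21) (g1) (A-even per-vertex glue, F0P3-p02 (g17) ∕ A-p19 (g29)).  ★ `exists_adaptedAxisFrame_of_mem_rootRegion` derived
the axis property `e₁ ∈ v.1` from the regime-B keys; everything after that step is literal-agnostic.  This file states that remainder once with `e₁ ∈ v.1` as a HYPOTHESIS and
specialises it to the A-even TOP (axis by ★ p849253):
* **`exists_adaptedAxisFrame_of_single_mem`** — `e₁ ∈ v.1`, `SD`, `LEV(ϖ^{d₀})`, `d₀` odd, `|tr² − 4det| < |ϖ|^{2d₀}` ⇒ adapted J-symmetric AXIS block frame `u = ι(k,1)`, `k ∈ U(σ,Φ₂)`;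
* **`exists_adaptedAxisFrame_of_mem_rootRegion_of_top`** — the same at the A-even top (`B₀ ∈ U(σ,Φ₂)`, `|½tr B₀ − 1| ≤ |ϖ^{d₀+1}|`, `htop`), RULING (21) (g1).
HONEST LABEL: HC_CM is proved only modulo the 2 remaining named inputs (hLiu418 24832, h413 24833) until rung 0 closes; nothing printed is asserted here (lattice
bookkeeping over ★ results); «S3-ram» is Literature seeding, count-neutral.

## References
* [Kottwitz1986] R. E. Kottwitz, *Base change for unit elements of Hecke algebras*, Compositio Math. 60 (1986), §3.
* [Rogawski1990] J. D. Rogawski, *Automorphic Representations of Unitary Groups in Three Variables*, Ann. of Math. Stud. 123 (1990), §4.8 Case (a) p. 53, §4.9 pp. 54–56, Lemma 4.9.3.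
* [BruhatTits1972] F. Bruhat, J. Tits, *Groupes réductifs sur un corps local I*, Publ. Math. IHÉS 41 (1972), §10.
* [Jacobowitz1962] R. Jacobowitz, *Hermitian forms over local fields*, Amer. J. Math. 84 (1962), §7–§8.
-/

set_option autoImplicit false

noncomputable section

open scoped Valued WithZero Matrix MatrixGroups
open Polynomial Classical SimpleGraph
open Literature.NumberTheory.Automorphic Literature.NumberTheory.Automorphic.HermitianLattice Literature.NumberTheory.Automorphic.UnitaryLatticeTree
open Literature.NumberTheory.Automorphic.UnitaryGroup

namespace Literature.NumberTheory.Rogawski1990.TypeOneRamifiedJunction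

variable {K : Type*} [Field K] [Valued K ℤᵐ⁰] {σ : K →+* K} {ϖ : K}

set_option maxHeartbeats 1600000 in
/-- **(K4b-F′) THE ADAPTED AXIS BLOCK FRAME OF AN AXIS REGION VERTEX — literal-agnostic form.**  Let `↑γ = ι(B₀, 1)` with `|tr(B₀)² − 4det B₀| < |ϖ|^{2d₀}`, `d₀` odd,
`|2| = 1`, `σϖ = −ϖ`, and let `v` be a region vertex (`γ·v = v`, `SD v.1`, `(γ − 1)·v.1 ≤ ϖ^{d₀}·v.1`) ON THE AXIS: `e₁ ∈ v.1` (regime B: ★ p849125; A-even top: ★ p849253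
`single_one_one_mem_of_mem_rootRegion_of_top`).  Then `v = u·r₀` for an AXIS frame `u = ι(k, 1)`, `k ∈ U(σ, Φ₂)`, with `↑(u⁻¹γu) = ι(g₁, 1)`, `tr g₁ = tr B₀`, `det g₁ = det B₀`,
`|(g₁ − 1)ᵢⱼ| ≤ |ϖ|^{d₀}`, ADAPTED `|ϖ^{−d₀}g₁,₁₀| < 1`, J-SYMMETRIC `|ϖ^{−d₀}((g₁−1)₀₀ − (g₁−1)₁₁)| < 1` — the proof of ★ `exists_adaptedAxisFrame_of_mem_rootRegion` from step (b) on.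
[cite: BruhatTits1972, §10] [cite: Kottwitz1986, §3] [cite: Rogawski1990, §4.9 Lemma 4.9.3 p. 56] [cite: Jacobowitz1962, §8] -/
theorem exists_adaptedAxisFrame_of_single_mem
    (hσ : ∀ x, σ (σ x) = x) (hvσ : ∀ a, Valued.v (σ a) = Valued.v a) (hσϖ : σ ϖ = -ϖ)
    (hϖ : Valued.v ϖ = WithZero.exp (-1 : ℤ)) (hres : ∀ x : K, Valued.v x ≤ 1 → Valued.v (σ x - x) < 1) (h2 : Valued.v (2 : K) = 1)
    (γ : unitaryGroupOfForm σ ((StdForm.antidiagonal 3).over K)) (B₀ : GL (Fin 2) K) (hγ : (γ : GL (Fin 3) K) = endoGL (B₀, (1 : GL (Fin 1) K)))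
    {d₀ : ℕ} (hodd : Odd d₀)
    (hdisc : Valued.v ((B₀ : Matrix (Fin 2) (Fin 2) K).trace ^ 2 - 4 * (B₀ : Matrix (Fin 2) (Fin 2) K).det) < Valued.v ϖ ^ (2 * d₀))
    {v : {M : Submodule 𝒪[K] (Fin 3 → K) // IsVertex σ ϖ ((StdForm.antidiagonal 3).over K) M}}
    (he : (Pi.single 1 1 : Fin 3 → K) ∈ v.1) (hv : IsSelfDualLattice σ ϖ ((StdForm.antidiagonal 3).over K) v.1)
    (hvR : v.1.map ((Matrix.toLin' (((γ : GL (Fin 3) K) : Matrix (Fin 3) (Fin 3) K) - 1)).restrictScalars 𝒪[K]) ≤ scaleLattice (ϖ ^ d₀) v.1) :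
    ∃ k : GL (Fin 2) K, k ∈ unitaryGroupOfForm σ ((StdForm.antidiagonal 2).over K) ∧
      ∃ u : unitaryGroupOfForm σ ((StdForm.antidiagonal 3).over K), (u : GL (Fin 3) K) = endoGL (k, (1 : GL (Fin 1) K)) ∧
        v = latticeGraphIso σ ϖ ((StdForm.antidiagonal 3).over K) u ⟨stdLattice K 3, 0, isSelfDualLattice_stdLattice_three_of_v hϖ⟩ ∧
        ∃ g₁ : GL (Fin 2) K, ((u⁻¹ * γ * u : unitaryGroupOfForm σ ((StdForm.antidiagonal 3).over K)) : GL (Fin 3) K) = endoGL (g₁, (1 : GL (Fin 1) K)) ∧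
          (g₁ : Matrix (Fin 2) (Fin 2) K).trace = (B₀ : Matrix (Fin 2) (Fin 2) K).trace ∧ (g₁ : Matrix (Fin 2) (Fin 2) K).det = (B₀ : Matrix (Fin 2) (Fin 2) K).det ∧
          (∀ i j, Valued.v (((g₁ : Matrix (Fin 2) (Fin 2) K) - 1) i j) ≤ Valued.v ϖ ^ d₀) ∧
          Valued.v ((ϖ ^ d₀)⁻¹ * (g₁ : Matrix (Fin 2) (Fin 2) K) 1 0) < 1 ∧
          Valued.v ((ϖ ^ d₀)⁻¹ * ((((g₁ : Matrix (Fin 2) (Fin 2) K) - 1) 0 0) - (((g₁ : Matrix (Fin 2) (Fin 2) K) - 1) 1 1))) < 1 := by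
  have hϖ0 : ϖ ≠ 0 := fun h0 => by rw [h0, map_zero] at hϖ; exact WithZero.coe_ne_zero hϖ.symm
  have hvϖ0 : Valued.v ϖ ≠ 0 := (Valuation.ne_zero_iff _).2 hϖ0
  have hϖ1 : Valued.v ϖ ≤ 1 := by rw [hϖ, ← WithZero.exp_zero]; exact WithZero.exp_le_exp.2 (by norm_num)
  have hϖD0 : (ϖ ^ d₀ : K) ≠ 0 := pow_ne_zero _ hϖ0
  -- (b) an endoscopic block frame of the lattice
  obtain ⟨g₃, hMg, -, -, -⟩ := id hv
  have hSD' : IsSelfDualLattice σ ϖ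
      (!![(!![(0 : K), 1; 1, 0] : Matrix (Fin 2) (Fin 2) K) 0 0, 0, (!![(0 : K), 1; 1, 0] : Matrix (Fin 2) (Fin 2) K) 0 1; 0, (1 : K), 0;
        (!![(0 : K), 1; 1, 0] : Matrix (Fin 2) (Fin 2) K) 1 0, 0, (!![(0 : K), 1; 1, 0] : Matrix (Fin 2) (Fin 2) K) 1 1] : Matrix (Fin 3) (Fin 3) K) v.1 := by
    rw [← antidiagonal_three_over_eq_endoShape]; exact hv
  have hH₂ : IsUnit (!![(0 : K), 1; 1, 0] : Matrix (Fin 2) (Fin 2) K).det := by rw [Matrix.det_fin_two]; simp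
  have hHdet : IsUnit (!![(!![(0 : K), 1; 1, 0] : Matrix (Fin 2) (Fin 2) K) 0 0, 0, (!![(0 : K), 1; 1, 0] : Matrix (Fin 2) (Fin 2) K) 0 1; 0, (1 : K), 0;
        (!![(0 : K), 1; 1, 0] : Matrix (Fin 2) (Fin 2) K) 1 0, 0, (!![(0 : K), 1; 1, 0] : Matrix (Fin 2) (Fin 2) K) 1 1] : Matrix (Fin 3) (Fin 3) K).det := by
    rw [← antidiagonal_three_over_eq_endoShape]; exact isUnit_det_antidiagonal
  have hax : ∀ x ∈ v.1, Valued.v (x 1) ≤ 1 := by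
    intro x hx
    have hdual := dualLatt_eq_self_of_isSelfDualLattice hvσ hHdet hSD'
    have hx' : x ∈ dualLatt σ (!![(!![(0 : K), 1; 1, 0] : Matrix (Fin 2) (Fin 2) K) 0 0, 0, (!![(0 : K), 1; 1, 0] : Matrix (Fin 2) (Fin 2) K) 0 1; 0, (1 : K), 0;
        (!![(0 : K), 1; 1, 0] : Matrix (Fin 2) (Fin 2) K) 1 0, 0, (!![(0 : K), 1; 1, 0] : Matrix (Fin 2) (Fin 2) K) 1 1] : Matrix (Fin 3) (Fin 3) K) v.1 := by
      rw [hdual]; exact hx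
    have hp := hx' _ he
    rw [pairing_endoShape_apply] at hp
    have e0 : (![(Pi.single 1 1 : Fin 3 → K) 0, (Pi.single 1 1 : Fin 3 → K) 2] : Fin 2 → K) = 0 := by ext i; fin_cases i <;> simp
    rw [e0, map_zero, LinearMap.zero_apply, zero_add] at hp
    simpa using hp
  obtain ⟨g₂, hg₂⟩ := exists_latt_endoGL_eq_of_single_mem g₃ (by rw [← hMg]; exact he) (by rw [← hMg]; exact hax)
  -- (c) the W-block lattice is self-dual, hence `k·𝒪²` for a unitary `k`
  have hSD₂ : IsSelfDualLattice σ ϖ ((StdForm.antidiagonal 2).over K) (latt (g₂ : Matrix (Fin 2) (Fin 2) K)) := by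
    have hΦ₂ : (StdForm.antidiagonal 2).over K = !![(0 : K), 1; 1, 0] := by
      ext i j; fin_cases i <;> fin_cases j <;> simp [StdForm.over, StdForm.antidiagonal_J_apply]
    rw [hΦ₂, ← isSelfDualLattice_latt_endoGL_one_iff σ hvσ hϖ0 hϖ1 _ (h := (1 : K)) (by rw [map_one]) g₂, hg₂, ← hMg]
    exact hSD'
  obtain ⟨k, hk⟩ := exists_unitary_mapGL_stdLattice_eq_of_isSelfDualLattice_two_of_v_two hσ hvσ hϖ h2 hSD₂
  have hlatt₂ : latt (g₂ : Matrix (Fin 2) (Fin 2) K) = latt ((k : GL (Fin 2) K) : Matrix (Fin 2) (Fin 2) K) := hk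
  have hvk : v.1 = latt ((endoGL ((k : GL (Fin 2) K), (1 : GL (Fin 1) K)) : GL (Fin 3) K) : Matrix (Fin 3) (Fin 3) K) := by
    rw [hMg, ← hg₂]; exact (latt_endoGL_one_eq_iff _ _).2 hlatt₂
  -- (d) J-symmetry and the off-diagonal dichotomy of `k₁⁻¹ B₀ k₁` for ANY unitary `k₁` with `v = ι(k₁,1)·r₀`
  have key : ∀ k₁ : GL (Fin 2) K, k₁ ∈ unitaryGroupOfForm σ ((StdForm.antidiagonal 2).over K) →
      v.1 = latt ((endoGL (k₁, (1 : GL (Fin 1) K)) : GL (Fin 3) K) : Matrix (Fin 3) (Fin 3) K) →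
      ∃ u : unitaryGroupOfForm σ ((StdForm.antidiagonal 3).over K), (u : GL (Fin 3) K) = endoGL (k₁, (1 : GL (Fin 1) K)) ∧
        v = latticeGraphIso σ ϖ ((StdForm.antidiagonal 3).over K) u ⟨stdLattice K 3, 0, isSelfDualLattice_stdLattice_three_of_v hϖ⟩ ∧
        ((u⁻¹ * γ * u : unitaryGroupOfForm σ ((StdForm.antidiagonal 3).over K)) : GL (Fin 3) K) = endoGL (k₁⁻¹ * B₀ * k₁, (1 : GL (Fin 1) K)) ∧
        (∀ i j, Valued.v (((((k₁⁻¹ * B₀ * k₁ : GL (Fin 2) K)) : Matrix (Fin 2) (Fin 2) K) - 1) i j) ≤ Valued.v ϖ ^ d₀) ∧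
        Valued.v ((ϖ ^ d₀)⁻¹ * (((((k₁⁻¹ * B₀ * k₁ : GL (Fin 2) K)) : Matrix (Fin 2) (Fin 2) K) - 1) 0 0 - ((((k₁⁻¹ * B₀ * k₁ : GL (Fin 2) K)) : Matrix (Fin 2) (Fin 2) K) - 1) 1 1)) < 1 ∧
        (Valued.v ((ϖ ^ d₀)⁻¹ * (((k₁⁻¹ * B₀ * k₁ : GL (Fin 2) K)) : Matrix (Fin 2) (Fin 2) K) 1 0) < 1 ∨
          Valued.v ((ϖ ^ d₀)⁻¹ * (((k₁⁻¹ * B₀ * k₁ : GL (Fin 2) K)) : Matrix (Fin 2) (Fin 2) K) 0 1) < 1) := by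
    intro k₁ hk₁ hvk₁
    let u : unitaryGroupOfForm σ ((StdForm.antidiagonal 3).over K) :=
      ⟨endoGL (k₁, (1 : GL (Fin 1) K)), endoGL_mem_unitaryGroupOfForm_antidiagonal_three hk₁ (Subgroup.one_mem _)⟩
    have hu : (u : GL (Fin 3) K) = endoGL (k₁, (1 : GL (Fin 1) K)) := rfl
    have hvu : v = latticeGraphIso σ ϖ ((StdForm.antidiagonal 3).over K) u ⟨stdLattice K 3, 0, isSelfDualLattice_stdLattice_three_of_v hϖ⟩ := by
      apply Subtype.ext
      rw [latticeGraphIso_apply_coe, hvk₁]; rfl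
    have hγu : ((u⁻¹ * γ * u : unitaryGroupOfForm σ ((StdForm.antidiagonal 3).over K)) : GL (Fin 3) K) = endoGL (k₁⁻¹ * B₀ * k₁, (1 : GL (Fin 1) K)) := by
      rw [Subgroup.coe_mul, Subgroup.coe_mul, Subgroup.coe_inv, hu, hγ, endoGL_one_inv_mul_endoGL_one_mul_endoGL_one]
    -- depth from the region token
    have hvR' := hvR
    rw [hvu] at hvR'
    have hdeep3 := (forall_v_conj_sub_one_le_iff_map_sub_one_le_scaleLattice γ u hϖD0).1 hvR'
    rw [hγu, coe_endoGL_sub_one_eq_endoShape, forall_v_endoShape_le_iff, map_pow] at hdeep3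
    have hdeep := hdeep3.1
    -- the dichotomy (★ (K3))
    have hTint : ∀ i j, Valued.v ((ϖ ^ d₀)⁻¹ * ((((k₁⁻¹ * B₀ * k₁ : GL (Fin 2) K)) : Matrix (Fin 2) (Fin 2) K) - 1) i j) ≤ 1 := fun i j => by
      rw [map_mul, map_inv₀, map_pow]
      calc (Valued.v ϖ ^ d₀)⁻¹ * Valued.v (((((k₁⁻¹ * B₀ * k₁ : GL (Fin 2) K)) : Matrix (Fin 2) (Fin 2) K) - 1) i j) ≤ (Valued.v ϖ ^ d₀)⁻¹ * Valued.v ϖ ^ d₀ :=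
            mul_le_mul' le_rfl (hdeep i j)
        _ = 1 := inv_mul_cancel₀ (pow_ne_zero _ hvϖ0)
    obtain ⟨T, hT⟩ : ∃ T : Matrix (Fin 2) (Fin 2) 𝒪[K], ∀ i j, ((T i j : 𝒪[K]) : K) = (ϖ ^ d₀)⁻¹ * ((((k₁⁻¹ * B₀ * k₁ : GL (Fin 2) K)) : Matrix (Fin 2) (Fin 2) K) - 1) i j :=
      ⟨Matrix.of fun i j => ⟨_, (Valuation.mem_integer_iff _ _).2 (hTint i j)⟩, fun i j => rfl⟩
    have hunit : endoGL (k₁⁻¹ * B₀ * k₁, (1 : GL (Fin 1) K)) ∈ unitaryGroupOfForm σ ((StdForm.antidiagonal 3).over K) := by rw [← hγu]; exact (u⁻¹ * γ * u).2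
    have hdisc₁ : Valued.v ((((k₁⁻¹ * B₀ * k₁ : GL (Fin 2) K)) : Matrix (Fin 2) (Fin 2) K).trace ^ 2 - 4 * (((k₁⁻¹ * B₀ * k₁ : GL (Fin 2) K)) : Matrix (Fin 2) (Fin 2) K).det) <
        Valued.v ϖ ^ (2 * d₀) := by
      rw [Units.val_mul, Units.val_mul, Matrix.trace_units_conj', Matrix.det_units_conj']; exact hdisc
    obtain ⟨hsym, hdich⟩ := residue_apply_eq_and_offDiag_dichotomy_of_unitary_two hvσ hσϖ hϖ hres h2 _ (block_mem_unitary_of_endoGL_mem hunit) hodd T hT hdisc₁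
    have hsymv : Valued.v ((ϖ ^ d₀)⁻¹ * (((((k₁⁻¹ * B₀ * k₁ : GL (Fin 2) K)) : Matrix (Fin 2) (Fin 2) K) - 1) 0 0 - ((((k₁⁻¹ * B₀ * k₁ : GL (Fin 2) K)) : Matrix (Fin 2) (Fin 2) K) - 1) 1 1)) < 1 := by
      have h := hsym
      rw [← sub_eq_zero, ← map_sub, residue_eq_zero_iff_v_lt_one] at h
      simpa [hT, mul_sub] using h
    refine ⟨u, hu, hvu, hγu, hdeep, hsymv, ?_⟩
    rcases hdich with h10 | h01
    · left
      rw [residue_eq_zero_iff_v_lt_one, hT, Matrix.sub_apply, Matrix.one_apply_ne (by decide), sub_zero] at h10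
      exact h10
    · right
      rw [residue_eq_zero_iff_v_lt_one, hT, Matrix.sub_apply, Matrix.one_apply_ne (by decide), sub_zero] at h01
      exact h01
  -- (e) conclude, flipping the W-frame if necessary
  have htrdet : ∀ k₁ : GL (Fin 2) K, (((k₁⁻¹ * B₀ * k₁ : GL (Fin 2) K)) : Matrix (Fin 2) (Fin 2) K).trace = (B₀ : Matrix (Fin 2) (Fin 2) K).trace ∧
      (((k₁⁻¹ * B₀ * k₁ : GL (Fin 2) K)) : Matrix (Fin 2) (Fin 2) K).det = (B₀ : Matrix (Fin 2) (Fin 2) K).det := fun k₁ => by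
    rw [Units.val_mul, Units.val_mul, Matrix.trace_units_conj', Matrix.det_units_conj']; exact ⟨rfl, rfl⟩
  obtain ⟨u, hu, hvu, hγu, hdeep, hsymv, hdich⟩ := key (k : GL (Fin 2) K) k.2 hvk
  rcases hdich with h10 | h01
  · exact ⟨(k : GL (Fin 2) K), k.2, u, hu, hvu, (k : GL (Fin 2) K)⁻¹ * B₀ * (k : GL (Fin 2) K), hγu, (htrdet _).1, (htrdet _).2, hdeep, h10, hsymv⟩
  · -- flip: `k' = k·w₀`
    obtain ⟨w, hw, hw'⟩ := (exists_flipTwo : ∃ w : GL (Fin 2) K, _)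
    have hwU : w ∈ unitaryGroupOfForm σ ((StdForm.antidiagonal 2).over K) := by
      have h := endoGL_flip_one_mem_unitary σ hw
      rw [← endoForm_antidiagonal_over, endoGL_mem_iff] at h
      exact h.1
    have hkw : (k : GL (Fin 2) K) * w ∈ unitaryGroupOfForm σ ((StdForm.antidiagonal 2).over K) := Subgroup.mul_mem _ k.2 hwU
    have hvkw : v.1 = latt ((endoGL ((k : GL (Fin 2) K) * w, (1 : GL (Fin 1) K)) : GL (Fin 3) K) : Matrix (Fin 3) (Fin 3) K) := by
      rw [hvk]
      refine (latt_endoGL_one_eq_iff _ _).2 ?_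
      -- `latt (k w₀) = latt k`: `w₀ ∈ GL₂(𝒪)`
      rw [Units.val_mul, latt_mul]
      have hwl : latt ((w : GL (Fin 2) K) : Matrix (Fin 2) (Fin 2) K) = stdLattice K 2 := by
        apply le_antisymm
        · rw [latt_le_stdLattice_iff, hw]; intro i j; fin_cases i <;> fin_cases j <;> simp
        · have h1 : stdLattice K 2 = latt (((w : GL (Fin 2) K) : Matrix (Fin 2) (Fin 2) K) * ((w : GL (Fin 2) K) : Matrix (Fin 2) (Fin 2) K)) := by
            rw [← Units.val_mul, show w * w = 1 from by
              rw [← inv_eq_iff_mul_eq_one]; exact Units.ext (hw'.trans hw.symm), Units.val_one, latt_one]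
          rw [h1, latt_mul]
          refine Submodule.map_mono ?_
          rw [latt_le_stdLattice_iff, hw]; intro i j; fin_cases i <;> fin_cases j <;> simp
      rw [hwl]; rfl
    obtain ⟨u', hu', hvu', hγu', hdeep', hsymv', hdich'⟩ := key ((k : GL (Fin 2) K) * w) hkw hvkw
    have hre : ((k : GL (Fin 2) K) * w)⁻¹ * B₀ * ((k : GL (Fin 2) K) * w) = w⁻¹ * ((k : GL (Fin 2) K)⁻¹ * B₀ * k) * w := by group
    refine ⟨(k : GL (Fin 2) K) * w, hkw, u', hu', hvu', ((k : GL (Fin 2) K) * w)⁻¹ * B₀ * ((k : GL (Fin 2) K) * w), hγu', (htrdet _).1, (htrdet _).2, hdeep', ?_, hsymv'⟩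
    rw [hre, coe_flip_inv_mul_mul_flip_apply hw hw', show Fin.rev (1 : Fin 2) = 0 from rfl, show Fin.rev (0 : Fin 2) = 1 from rfl]
    exact h01

set_option maxHeartbeats 1600000 in
/-- **(K4b-F-top) THE ADAPTED AXIS BLOCK FRAME OF A REGION VERTEX AT THE A-EVEN TOP** (chair RULING (21) (g1)): as ★ `exists_adaptedAxisFrame_of_mem_rootRegion`, with the
axis step supplied by ★ p849253 `single_one_one_mem_of_mem_rootRegion_of_top` (`B₀ ∈ U(σ, Φ₂)`, scalar part deeper `|½tr B₀ − 1| ≤ |ϖ^{d₀+1}|`, top centred ball empty `htop`),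
and the small discriminant `|tr² − 4det| < |ϖ|^{2d₀}` (A-even: `= |ϖ|^{2(d₀+1)}`).  For F0P3-p02 (g17) ∕ A-p19 (g29)'s A-even per-vertex census.
[cite: BruhatTits1972, §10] [cite: Kottwitz1986, §3] [cite: Rogawski1990, §4.9 Lemma 4.9.3 p. 56] -/
theorem exists_adaptedAxisFrame_of_mem_rootRegion_of_top [IsPrincipalIdealRing 𝒪[K]]
    (hσ : ∀ x, σ (σ x) = x) (hvσ : ∀ a, Valued.v (σ a) = Valued.v a) (hσϖ : σ ϖ = -ϖ)
    (hϖ : Valued.v ϖ = WithZero.exp (-1 : ℤ)) (hres : ∀ x : K, Valued.v x ≤ 1 → Valued.v (σ x - x) < 1) (h2 : Valued.v (2 : K) = 1)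
    (γ : unitaryGroupOfForm σ ((StdForm.antidiagonal 3).over K)) (B₀ : GL (Fin 2) K) (hγ : (γ : GL (Fin 3) K) = endoGL (B₀, (1 : GL (Fin 1) K)))
    (hγU : B₀ ∈ unitaryGroupOfForm σ (!![(0 : K), 1; 1, 0] : Matrix (Fin 2) (Fin 2) K)) {d₀ : ℕ} (hodd : Odd d₀)
    (hdisc : Valued.v ((B₀ : Matrix (Fin 2) (Fin 2) K).trace ^ 2 - 4 * (B₀ : Matrix (Fin 2) (Fin 2) K).det) < Valued.v ϖ ^ (2 * d₀))
    (hα : Valued.v ((B₀ : Matrix (Fin 2) (Fin 2) K).trace / 2 - ((1 : GL (Fin 1) K) : Matrix (Fin 1) (Fin 1) K) 0 0) ≤ Valued.v (ϖ ^ (d₀ + 1)))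
    (htop : {B : Submodule 𝒪[K] (Fin 2 → K) | IsSelfDualLattice σ ϖ (!![(0 : K), 1; 1, 0] : Matrix (Fin 2) (Fin 2) K) B ∧ mapGL B₀ B = B ∧
        B.map ((Matrix.toLin' ((B₀ : Matrix (Fin 2) (Fin 2) K) - ((B₀ : Matrix (Fin 2) (Fin 2) K).trace / 2) • (1 : Matrix (Fin 2) (Fin 2) K))).restrictScalars 𝒪[K]) ≤
          scaleLattice (ϖ ^ (d₀ + 1)) B} = ∅)
    {v : {M : Submodule 𝒪[K] (Fin 3 → K) // IsVertex σ ϖ ((StdForm.antidiagonal 3).over K) M}}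
    (hfix : latticeGraphIso σ ϖ ((StdForm.antidiagonal 3).over K) γ v = v) (hv : IsSelfDualLattice σ ϖ ((StdForm.antidiagonal 3).over K) v.1)
    (hvR : v.1.map ((Matrix.toLin' (((γ : GL (Fin 3) K) : Matrix (Fin 3) (Fin 3) K) - 1)).restrictScalars 𝒪[K]) ≤ scaleLattice (ϖ ^ d₀) v.1) :
    ∃ k : GL (Fin 2) K, k ∈ unitaryGroupOfForm σ ((StdForm.antidiagonal 2).over K) ∧
      ∃ u : unitaryGroupOfForm σ ((StdForm.antidiagonal 3).over K), (u : GL (Fin 3) K) = endoGL (k, (1 : GL (Fin 1) K)) ∧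
        v = latticeGraphIso σ ϖ ((StdForm.antidiagonal 3).over K) u ⟨stdLattice K 3, 0, isSelfDualLattice_stdLattice_three_of_v hϖ⟩ ∧
        ∃ g₁ : GL (Fin 2) K, ((u⁻¹ * γ * u : unitaryGroupOfForm σ ((StdForm.antidiagonal 3).over K)) : GL (Fin 3) K) = endoGL (g₁, (1 : GL (Fin 1) K)) ∧
          (g₁ : Matrix (Fin 2) (Fin 2) K).trace = (B₀ : Matrix (Fin 2) (Fin 2) K).trace ∧ (g₁ : Matrix (Fin 2) (Fin 2) K).det = (B₀ : Matrix (Fin 2) (Fin 2) K).det ∧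
          (∀ i j, Valued.v (((g₁ : Matrix (Fin 2) (Fin 2) K) - 1) i j) ≤ Valued.v ϖ ^ d₀) ∧
          Valued.v ((ϖ ^ d₀)⁻¹ * (g₁ : Matrix (Fin 2) (Fin 2) K) 1 0) < 1 ∧
          Valued.v ((ϖ ^ d₀)⁻¹ * ((((g₁ : Matrix (Fin 2) (Fin 2) K) - 1) 0 0) - (((g₁ : Matrix (Fin 2) (Fin 2) K) - 1) 1 1))) < 1 := by
  exact exists_adaptedAxisFrame_of_single_mem hσ hvσ hσϖ hϖ hres h2 γ B₀ hγ hodd hdisc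
    (single_one_one_mem_of_mem_rootRegion_of_top hσ hvσ hϖ h2 γ B₀ 1 hγ hγU hα htop v ⟨hfix, hv, hvR⟩) hv hvR

end Literature.NumberTheory.Rogawski1990.TypeOneRamifiedJunction

end
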